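import Mathlib
import Summits.Ventures.PercRepro2.Independence
import Summits.Ventures.PercRepro2.Harris
import Summits.Ventures.PercRepro2.HCov
import Summits.Ventures.PercRepro2.CutVertexPaths
import Summits.Ventures.PercRepro2.CutOneFarConn
import Summits.Ventures.PercRepro2.CutTwoFarConn
import Summits.Ventures.PercRepro2.CutTwoFarLaw
import Summits.Ventures.PercRepro2.CutTwoFar
import Summits.Ventures.PercRepro2.CutTwoFarHarris
import Summits.Ventures.PercRepro2.CutTwoFarRootsLaw
import Summits.Ventures.PercRepro2.CutTwoFarRightPat
import Summits.Ventures.PercRepro2.PendantRoot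
import Summits.Ventures.PercRepro2.CutTwoFarROConn
import Summits.Ventures.PercRepro2.CutTwoFarROMasses
import Summits.Ventures.PercRepro2.CutTwoFarRO

/-!
# A root and `o` behind a cut vertex, IV: THREE OF THE FOUR ENDPOINT NUMBERS ARE NONNEGATIVE
(blind cell PercRepro2, typer-1 g50)

Of the four endpoint numbers of the T6 reduction (`CutTwoFarRO.lean`, MINE2-CUTVERTEX §13.8),
`γₒ(0) ≥ 0` by Harris (`b ↔ a₂` increasing against `v ↮ a₂, a₃ ↮ v` decreasing: `gamma0_ro_nonneg`),
`hₒ(0) ≥ 0` by BHK06 1.3 (`PendantRoot.covC_cross_nonpos` at the roots `(v, a₂)`) and Harris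
(`h0_ro_nonneg`), `hₒ(1) ≥ 0` by BHK06 1.3 twice (`h1_ro_nonneg`).  Hence **`HCov_a1oFar_of_gamma1`**:
(HCOV) on the class `{a₁, o}` of S3.5 follows from the single number `γₒ(1) ≥ 0` (mine-2's lemma
(L6), `RootLeafO` — not matched here).  Own work; standard axioms.
-/

namespace Summit.Ventures.PercRepro2

open CovForm CutVertexM9 UnionCluster

namespace CutTwoFar

section ROSigns

variable {V : Type*} {E : Type*} [Fintype E] [DecidableEq E] {R : Type*} [Field R]
variable {ends : E → Sym2 V} {side : E → Bool} {L : Set V} {v : V} {Rt : Set V}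

variable [Fintype V] [DecidableEq V] [LinearOrder R] [IsStrictOrderedRing R]
variable (ends : E → Sym2 V) (v a₂ a₃ b : V) {p : E → R} (hp : IsProbVec p)
include hp

omit [Fintype V] [DecidableEq V] in
/-- Harris: `P(v ↮ a₂, b ↔ a₂, a₃ ↮ v) ≤ P(b ↔ a₂) · P(v ↮ a₂, a₃ ↮ v)`. -/
lemma betab_le :
    prob p {ω | ¬ Conn ends ω v a₂ ∧ Conn ends ω b a₂ ∧ ¬ Conn ends ω a₃ v} ≤ prob p {ω | Conn ends ω b a₂} * prob p {ω | ¬ Conn ends ω v a₂ ∧ ¬ Conn ends ω a₃ v} := by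
  have hset : {ω : Config E | ¬ Conn ends ω v a₂ ∧ Conn ends ω b a₂ ∧ ¬ Conn ends ω a₃ v} =
      ((connEvent ends v a₂)ᶜ ∩ (connEvent ends a₃ v)ᶜ) ∩ connEvent ends b a₂ := by
    ext ω
    simp only [Set.mem_setOf_eq, Set.mem_inter_iff, Set.mem_compl_iff, mem_connEvent]
    tauto
  have hset2 : {ω : Config E | ¬ Conn ends ω v a₂ ∧ ¬ Conn ends ω a₃ v} =
      (connEvent ends v a₂)ᶜ ∩ (connEvent ends a₃ v)ᶜ := by
    ext ω
    simp only [Set.mem_setOf_eq, Set.mem_inter_iff, Set.mem_compl_iff, mem_connEvent]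
  have hset3 : {ω : Config E | Conn ends ω b a₂} = connEvent ends b a₂ := rfl
  rw [hset, hset2, hset3, mul_comm]
  exact prob_inter_le_prob_mul_prob_of_isLowerSet hp
    ((isUpperSet_connEvent ends v a₂).compl.inter (isUpperSet_connEvent ends a₃ v).compl)
    (isUpperSet_connEvent ends b a₂)

omit [Fintype V] [DecidableEq V] in
/-- **`γₒ(0) ≥ 0`** (Harris). -/
lemma gamma0_ro_nonneg : 0 ≤ 2 * prob p {ω | ¬ Conn ends ω a₃ a₂} * (prob p {ω | ¬ Conn ends ω v a₂ ∧ Conn ends ω b v ∧ Conn ends ω a₃ a₂} - prob p {ω | ¬ Conn ends ω v a₂ ∧ Conn ends ω b a₂ ∧ ¬ Conn ends ω a₃ v} + prob p {ω | Conn ends ω b a₂} * prob p {ω | ¬ Conn ends ω v a₂ ∧ ¬ Conn ends ω a₃ v}) := by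
  have h1 := betab_le ends v a₂ a₃ b hp
  have h2 := prob_nonneg hp {ω : Config E | ¬ Conn ends ω a₃ a₂}
  have h3 := prob_nonneg hp {ω : Config E | ¬ Conn ends ω v a₂ ∧ Conn ends ω b v ∧ Conn ends ω a₃ a₂}
  have h4 : (0 : R) ≤ 2 := by norm_num
  exact mul_nonneg (mul_nonneg h4 h2) (by linarith)

/-- BHK06 1.3 at the roots `(v, a₂)`: `P(Q′) · P(Q′, b ↔ a₂, a₃ ↔ v) ≤ P(Q′, b ↔ a₂) · P(Q′, a₃ ↔ v)`. -/
lemma bhk_bH3L :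
    prob p {ω | ¬ Conn ends ω v a₂} * prob p {ω | ¬ Conn ends ω v a₂ ∧ Conn ends ω b a₂ ∧ Conn ends ω a₃ v} ≤ prob p {ω | ¬ Conn ends ω v a₂ ∧ Conn ends ω b a₂} * prob p {ω | ¬ Conn ends ω v a₂ ∧ Conn ends ω a₃ v} := by
  have key := (PendantRoot.covC_cross_nonpos p ends hp b v a₂ a₃).1
  unfold PendantRoot.covC at key
  have e1 : avoidAll ends a₂ {v} = {ω : Config E | ¬ Conn ends ω v a₂} := by
    ext ω
    simp only [avoidAll, Set.mem_setOf_eq, Finset.mem_singleton, forall_eq]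
    exact ⟨fun h hc => h (conn_symm hc), fun h hc => h (conn_symm hc)⟩
  have e2 : avoidAll ends a₂ {v} ∩ (connEvent ends a₂ b ∩ connEvent ends v a₃) =
      {ω : Config E | ¬ Conn ends ω v a₂ ∧ Conn ends ω b a₂ ∧ Conn ends ω a₃ v} := by
    ext ω
    simp only [avoidAll, Set.mem_inter_iff, Set.mem_setOf_eq, Finset.mem_singleton, forall_eq,
      mem_connEvent]
    exact ⟨fun ⟨h1, h2, h3⟩ => ⟨fun hc => h1 (conn_symm hc), conn_symm h2, conn_symm h3⟩,
      fun ⟨h1, h2, h3⟩ => ⟨fun hc => h1 (conn_symm hc), conn_symm h2, conn_symm h3⟩⟩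
  have e3 : avoidAll ends a₂ {v} ∩ connEvent ends a₂ b =
      {ω : Config E | ¬ Conn ends ω v a₂ ∧ Conn ends ω b a₂} := by
    ext ω
    simp only [avoidAll, Set.mem_inter_iff, Set.mem_setOf_eq, Finset.mem_singleton, forall_eq,
      mem_connEvent]
    exact ⟨fun ⟨h1, h2⟩ => ⟨fun hc => h1 (conn_symm hc), conn_symm h2⟩,
      fun ⟨h1, h2⟩ => ⟨fun hc => h1 (conn_symm hc), conn_symm h2⟩⟩
  have e4 : avoidAll ends a₂ {v} ∩ connEvent ends v a₃ =
      {ω : Config E | ¬ Conn ends ω v a₂ ∧ Conn ends ω a₃ v} := by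
    ext ω
    simp only [avoidAll, Set.mem_inter_iff, Set.mem_setOf_eq, Finset.mem_singleton, forall_eq,
      mem_connEvent]
    exact ⟨fun ⟨h1, h2⟩ => ⟨fun hc => h1 (conn_symm hc), conn_symm h2⟩,
      fun ⟨h1, h2⟩ => ⟨fun hc => h1 (conn_symm hc), conn_symm h2⟩⟩
  rw [e2, e3, e4, e1] at key
  linarith

/-- BHK06 1.3 at the roots `(v, a₂)`: `P(Q′) · P(Q′, b ↔ v, a₃ ↔ a₂) ≤ P(Q′, b ↔ v) · P(Q′, a₃ ↔ a₂)`. -/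
lemma bhk_bL3H :
    prob p {ω | ¬ Conn ends ω v a₂} * prob p {ω | ¬ Conn ends ω v a₂ ∧ Conn ends ω b v ∧ Conn ends ω a₃ a₂} ≤ prob p {ω | ¬ Conn ends ω v a₂ ∧ Conn ends ω b v} * prob p {ω | ¬ Conn ends ω v a₂ ∧ Conn ends ω a₃ a₂} := by
  have key := (PendantRoot.covC_cross_nonpos p ends hp b v a₂ a₃).2
  unfold PendantRoot.covC at key
  have e1 : avoidAll ends a₂ {v} = {ω : Config E | ¬ Conn ends ω v a₂} := by
    ext ω
    simp only [avoidAll, Set.mem_setOf_eq, Finset.mem_singleton, forall_eq]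
    exact ⟨fun h hc => h (conn_symm hc), fun h hc => h (conn_symm hc)⟩
  have e2 : avoidAll ends a₂ {v} ∩ (connEvent ends v b ∩ connEvent ends a₂ a₃) =
      {ω : Config E | ¬ Conn ends ω v a₂ ∧ Conn ends ω b v ∧ Conn ends ω a₃ a₂} := by
    ext ω
    simp only [avoidAll, Set.mem_inter_iff, Set.mem_setOf_eq, Finset.mem_singleton, forall_eq,
      mem_connEvent]
    exact ⟨fun ⟨h1, h2, h3⟩ => ⟨fun hc => h1 (conn_symm hc), conn_symm h2, conn_symm h3⟩,
      fun ⟨h1, h2, h3⟩ => ⟨fun hc => h1 (conn_symm hc), conn_symm h2, conn_symm h3⟩⟩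
  have e3 : avoidAll ends a₂ {v} ∩ connEvent ends v b =
      {ω : Config E | ¬ Conn ends ω v a₂ ∧ Conn ends ω b v} := by
    ext ω
    simp only [avoidAll, Set.mem_inter_iff, Set.mem_setOf_eq, Finset.mem_singleton, forall_eq,
      mem_connEvent]
    exact ⟨fun ⟨h1, h2⟩ => ⟨fun hc => h1 (conn_symm hc), conn_symm h2⟩,
      fun ⟨h1, h2⟩ => ⟨fun hc => h1 (conn_symm hc), conn_symm h2⟩⟩
  have e4 : avoidAll ends a₂ {v} ∩ connEvent ends a₂ a₃ =
      {ω : Config E | ¬ Conn ends ω v a₂ ∧ Conn ends ω a₃ a₂} := by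
    ext ω
    simp only [avoidAll, Set.mem_inter_iff, Set.mem_setOf_eq, Finset.mem_singleton, forall_eq,
      mem_connEvent]
    exact ⟨fun ⟨h1, h2⟩ => ⟨fun hc => h1 (conn_symm hc), conn_symm h2⟩,
      fun ⟨h1, h2⟩ => ⟨fun hc => h1 (conn_symm hc), conn_symm h2⟩⟩
  rw [e2, e3, e4, e1] at key
  linarith

/-- **`hₒ(1) ≥ 0`** (BHK06 1.3 twice). -/
lemma h1_ro_nonneg : 0 ≤ 2 * prob p {ω | Conn ends ω v a₂ ∧ ¬ Conn ends ω a₃ a₂} * (-(prob p {ω | ¬ Conn ends ω v a₂} * prob p {ω | ¬ Conn ends ω v a₂ ∧ Conn ends ω b a₂ ∧ Conn ends ω a₃ v} - prob p {ω | ¬ Conn ends ω v a₂ ∧ Conn ends ω b a₂} * prob p {ω | ¬ Conn ends ω v a₂ ∧ Conn ends ω a₃ v}) - (prob p {ω | ¬ Conn ends ω v a₂} * prob p {ω | ¬ Conn ends ω v a₂ ∧ Conn ends ω b v ∧ Conn ends ω a₃ a₂} - prob p {ω | ¬ Conn ends ω v a₂ ∧ Conn ends ω b v} * prob p {ω | ¬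 Conn ends ω v a₂ ∧ Conn ends ω a₃ a₂}) + prob p {ω | ¬ Conn ends ω v a₂ ∧ Conn ends ω b v} * prob p {ω | ¬ Conn ends ω v a₂ ∧ ¬ (Conn ends ω a₃ v ∨ Conn ends ω a₃ a₂)}) := by
  have h1 := bhk_bH3L ends v a₂ a₃ b hp
  have h2 := bhk_bL3H ends v a₂ a₃ b hp
  have h3 := prob_nonneg hp {ω : Config E | Conn ends ω v a₂ ∧ ¬ Conn ends ω a₃ a₂}
  have h4 := prob_nonneg hp {ω : Config E | ¬ Conn ends ω v a₂ ∧ Conn ends ω b v}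
  have h5 := prob_nonneg hp {ω : Config E | ¬ Conn ends ω v a₂ ∧ ¬ (Conn ends ω a₃ v ∨ Conn ends ω a₃ a₂)}
  have h6 : (0 : R) ≤ 2 := by norm_num
  exact mul_nonneg (mul_nonneg h6 h3) (by nlinarith [mul_nonneg h4 h5])

omit [Fintype V] [DecidableEq V] in
/-- Harris: `P(Q′, b ↔ a₂) ≤ P(Q′) · P(b ↔ a₂)`. -/
lemma QbH_le : prob p {ω | ¬ Conn ends ω v a₂ ∧ Conn ends ω b a₂} ≤ prob p {ω | ¬ Conn ends ω v a₂} * prob p {ω | Conn ends ω b a₂} := by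
  have hset : {ω : Config E | ¬ Conn ends ω v a₂ ∧ Conn ends ω b a₂} =
      (connEvent ends v a₂)ᶜ ∩ connEvent ends b a₂ := by
    ext ω
    simp only [Set.mem_setOf_eq, Set.mem_inter_iff, Set.mem_compl_iff, mem_connEvent]
  have hset2 : {ω : Config E | ¬ Conn ends ω v a₂} = (connEvent ends v a₂)ᶜ := by
    ext ω
    simp only [Set.mem_setOf_eq, Set.mem_compl_iff, mem_connEvent]
  have hset3 : {ω : Config E | Conn ends ω b a₂} = connEvent ends b a₂ := rfl
  rw [hset, hset2, hset3]
  exact prob_inter_le_prob_mul_prob_of_isLowerSet hp (isUpperSet_connEvent ends v a₂).compl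
    (isUpperSet_connEvent ends b a₂)

/-- **`hₒ(0) ≥ 0`** (BHK06 1.3 + Harris; the case `P(Q′) = 0` by monotonicity). -/
lemma h0_ro_nonneg : 0 ≤ 2 * prob p {ω | Conn ends ω v a₂ ∧ ¬ Conn ends ω a₃ a₂} * (prob p {ω | ¬ Conn ends ω v a₂ ∧ Conn ends ω b v ∧ ¬ Conn ends ω a₃ a₂} + (prob p {ω | Conn ends ω b a₂} * prob p {ω | ¬ Conn ends ω v a₂ ∧ Conn ends ω a₃ v} - prob p {ω | ¬ Conn ends ω v a₂ ∧ Conn ends ω b a₂ ∧ Conn ends ω a₃ v})) := by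
  have hB := bhk_bH3L ends v a₂ a₃ b hp
  have hH := QbH_le ends v a₂ b hp
  have h3 := prob_nonneg hp {ω : Config E | Conn ends ω v a₂ ∧ ¬ Conn ends ω a₃ a₂}
  have hL := prob_nonneg hp {ω : Config E | ¬ Conn ends ω v a₂ ∧ Conn ends ω b v ∧ ¬ Conn ends ω a₃ a₂}
  have hPQ := prob_nonneg hp {ω : Config E | ¬ Conn ends ω v a₂}
  have h3L := prob_nonneg hp {ω : Config E | ¬ Conn ends ω v a₂ ∧ Conn ends ω a₃ v}
  have hbb := prob_nonneg hp {ω : Config E | Conn ends ω b a₂}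
  have h6 : (0 : R) ≤ 2 := by norm_num
  -- the bracket, cleared by `P(Q′)`
  have key : prob p {ω | ¬ Conn ends ω v a₂} * (prob p {ω | Conn ends ω b a₂} * prob p {ω | ¬ Conn ends ω v a₂ ∧ Conn ends ω a₃ v} - prob p {ω | ¬ Conn ends ω v a₂ ∧ Conn ends ω b a₂ ∧ Conn ends ω a₃ v}) ≥ 0 := by
    nlinarith [mul_le_mul_of_nonneg_right hH h3L]
  rcases (prob_nonneg hp {ω : Config E | ¬ Conn ends ω v a₂}).lt_or_eq with hpos | hzero
  · have := (mul_nonneg_iff_of_pos_left hpos).mp key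
    exact mul_nonneg (mul_nonneg h6 h3) (by linarith)
  · -- `P(Q′) = 0` forces the two sub-events to have probability `0`
    have hsub1 : prob p {ω | ¬ Conn ends ω v a₂ ∧ Conn ends ω b a₂ ∧ Conn ends ω a₃ v} ≤ prob p {ω | ¬ Conn ends ω v a₂} :=
      prob_mono hp fun ω hω => hω.1
    have hsub2 : prob p {ω | ¬ Conn ends ω v a₂ ∧ Conn ends ω a₃ v} ≤ prob p {ω | ¬ Conn ends ω v a₂} :=
      prob_mono hp fun ω hω => hω.1
    have hb3 := prob_nonneg hp {ω : Config E | ¬ Conn ends ω v a₂ ∧ Conn ends ω b a₂ ∧ Conn ends ω a₃ v}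
    rw [← hzero] at hsub1 hsub2
    exact mul_nonneg (mul_nonneg h6 h3) (by nlinarith)

end ROSigns

/-! ## (HCOV) on the class from the single number `γₒ(1)` -/

section ROClass

variable {V : Type*} {E : Type*} [Fintype E] [DecidableEq E] {R : Type*} [Field R]
variable {ends : E → Sym2 V} {side : E → Bool} {L : Set V} {v : V} {Rt : Set V}
variable [Fintype V] [DecidableEq V] [LinearOrder R] [IsStrictOrderedRing R]
variable (h : CutVertex ends side L v Rt) {o b a₁ a₂ a₃ : V} (p : E → R)
include h

/-- **(HCOV) with a root and `o` behind a cut vertex, from `γₒ(1) ≥ 0` alone.** -/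
theorem HCov_a1oFar_of_gamma1 (h1 : a₁ ∈ L ∨ a₁ = v) (ho : o ∈ L ∨ o = v) (h2 : a₂ ∈ Rt ∨ a₂ = v)
    (h3 : a₃ ∈ Rt ∨ a₃ = v) (hb : b ∈ Rt ∨ b = v) (hp : IsProbVec p) (hg1 : 0 ≤ 2 * (prob p {ω | ¬ Conn ends ω v a₂} * prob p {ω | ¬ Conn ends ω v a₂ ∧ ¬ (Conn ends ω a₃ v ∨ Conn ends ω a₃ a₂)} * prob p {ω | Conn ends ω b a₂} + prob p {ω | ¬ Conn ends ω a₃ a₂} * prob p {ω | ¬ Conn ends ω v a₂} * (prob p {ω | ¬ Conn ends ω v a₂ ∧ Conn ends ω b v ∧ Conn ends ω a₃ a₂} - prob p {ω | ¬ Conn ends ω v a₂ ∧ Conn ends ω b a₂ ∧ ¬ Conn ends ω a₃ v}) + (prob p {ω | ¬ Conn ends ω v a₂ ∧ Conn ends ω b v} - prob p {ω | ¬ Conn ends ω v a₂ ∧ Conn ends ω b a₂}) * (prob p {ω | ¬ Conn ends ω v a₂ ∧ ¬ (Conn ends ω a₃ v ∨ Conn ends ω a₃ a₂)} * prob p {ω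 | Conn ends ω a₃ a₂} - prob p {ω | ¬ Conn ends ω a₃ a₂} * prob p {ω | ¬ Conn ends ω v a₂ ∧ Conn ends ω a₃ a₂}))) :
    HCov p ends o a₁ a₂ a₃ b :=
  HCov_a1oFar_of_endpoints h p h1 ho h2 h3 hb hp (gamma0_ro_nonneg ends v a₂ a₃ b hp) hg1
    (h0_ro_nonneg ends v a₂ a₃ b hp) (h1_ro_nonneg ends v a₂ a₃ b hp)

end ROClass

end CutTwoFar

end Summit.Ventures.PercRepro2
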